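import Mathlib.RingTheory.Ideal.Height
import Mathlib.RingTheory.Localization.Submodule
import Mathlib.RingTheory.RegularLocalRing.Defs
import Literature.AlgebraicGeometry.Resolution.QuadraticTransforms
import Literature.AlgebraicGeometry.Resolution.QuadraticTransformsRegular
import Literature.AlgebraicGeometry.Resolution.ValuationSubringCoarseningDim
import Literature.AlgebraicGeometry.Resolution.ShannonValuationRankTwo
import HarnessLib

/-!
# Proof of `HeinzerEtAl2015ShannonValuationRankTwo` (Heinzer–Loper–Olberding–Schoutens–Toeniskoetter,
# arXiv:1505.06445, Thm. 8.1 (1) ⇒ (3) with Thm. 4.1 (1) / Rem. 4.3, branch form along a dominating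
# valuation ring)

Topic: `Literature/AlgebraicGeometry/Resolution`. DISCHARGE of the named fact
`HeinzerEtAl2015ShannonValuationRankTwo` (`ShannonValuationRankTwo.lean`; cell `res-hironaka`, rung L, slot
W4.1, crux `Steer` stmt-ResolutionOfSingularities-16345, S0 ν₁ side) by the tree, following the paper's own
elementary route (Lemma 3.2: blowing up the closed point is an isomorphism off the closed fibre) rather than
the boundary-valuation / Noetherian-hull machinery of §§4–5:

* `exists_eq_div_pow_of_mem_blowupRing` — elements of `R[𝔪/x]` are `c / x ^ N`, `c ∈ R`;
* `IsQuadraticTransform.exists_div_eq_descend` — HLOST Lemma 3.2 in valuation form: along a quadratic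
  transform `R → R₁ ⊆ O₁` whose centre on `R` is not the closed point (some element of `𝔪_R` is a unit of
  `O₁`), every fraction `a / b` over `R₁` with `b` a unit of `O₁` is such a fraction over `R`;
* `shannon_coarsening_isDiscreteValuationRing` — if `⋃ R i = O`, every proper coarsening `O < O₁ ≠ K` is
  the localisation of some member `R j` at the prime under `𝔪_{O₁}` (descent down to the first member
  containing a unit `y ∈ 𝔪_O` of `O₁`), hence a Noetherian valuation ring which is not a field, i.e. a
  discrete valuation ring (Mathlib `IsDiscreteValuationRing.TFAE`), and that prime has height `1`
  (`IsLocalization.AtPrime.ringKrullDim_eq_height`);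
* `HeinzerEtAl2015ShannonValuationRankTwo_holds` — the fact, by the counting lemmas of
  `ValuationSubringCoarseningDim.lean`.

All statements are about subrings of ONE field; no definitions. OURS (the formalisation); the mathematics is
[cite: HeinzerEtAl2015, Lemma 3.2, Thm. 4.1, Rem. 4.3, Thm. 8.1].
-/

noncomputable section

namespace Literature.AlgebraicGeometry.Resolution

open IsLocalRing

universe u

section ShannonDescent

variable {K : Type u} [Field K]

/-- Elements of the blow-up chart `R[𝔪/x]` (`x ∈ R`, `x ≠ 0`) are fractions `c / x ^ N` with `c ∈ R`.
[cite: Cutkosky2014, §2.1] [cite: HeinzerEtAl2015, proof of Lemma 3.2] -/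
theorem exists_eq_div_pow_of_mem_blowupRing {R : Subring K} [IsLocalRing R] {x : K} (hx : x ≠ 0)
    (hxR : x ∈ R) {z : K} (hz : z ∈ blowupRing R x) : ∃ c ∈ R, ∃ N : ℕ, z = c / x ^ N := by
  induction hz using Subring.closure_induction with
  | mem z hz =>
    rcases hz with hz | ⟨y, -, rfl⟩
    · exact ⟨z, hz, 0, by simp⟩
    · exact ⟨(y : K), y.2, 1, by simp⟩
  | zero => exact ⟨0, R.zero_mem, 0, by simp⟩
  | one => exact ⟨1, R.one_mem, 0, by simp⟩
  | add z w _ _ hz hw =>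
    obtain ⟨c, hc, N, rfl⟩ := hz
    obtain ⟨d, hd, M, rfl⟩ := hw
    refine ⟨c * x ^ M + d * x ^ N, R.add_mem (R.mul_mem hc (R.pow_mem hxR M))
      (R.mul_mem hd (R.pow_mem hxR N)), N + M, ?_⟩
    field_simp
    ring
  | neg z _ hz =>
    obtain ⟨c, hc, N, rfl⟩ := hz
    exact ⟨-c, R.neg_mem hc, N, by rw [neg_div]⟩
  | mul z w _ _ hz hw =>
    obtain ⟨c, hc, N, rfl⟩ := hz
    obtain ⟨d, hd, M, rfl⟩ := hw
    exact ⟨c * d, R.mul_mem hc hd, N + M, by rw [div_mul_div_comm, pow_add]⟩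

/-- **HLOST Lemma 3.2, one step, valuation form.** Let `R → R₁` be a quadratic transform inside a
valuation ring `O₁` (`R₁ ≤ O₁`) such that some element of `𝔪_R` is a unit of `O₁` (the centre of
`O₁` on `R` is NOT the closed point). Then every fraction `a / b` with `a, b ∈ R₁` and `b` a unit of
`O₁` is already a fraction `a' / b'` with `a', b' ∈ R` and `b'` a unit of `O₁`: the blowing up is an
isomorphism off the closed fibre, `R_{P} = (R₁)_{P₁}`. [cite: HeinzerEtAl2015, Lemma 3.2] -/
theorem IsQuadraticTransform.exists_div_eq_descend {R R₁ : Subring K} [IsLocalRing R]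
    (h : IsQuadraticTransform R R₁) (O₁ : ValuationSubring K) (hR₁ : R₁ ≤ O₁.toSubring)
    (hy : ∃ y : R, y ∈ maximalIdeal R ∧ O₁.valuation (y : K) = 1)
    {a b : K} (ha : a ∈ R₁) (hb : b ∈ R₁) (hvb : O₁.valuation b = 1) :
    ∃ a' ∈ R, ∃ b' ∈ R, O₁.valuation b' = 1 ∧ a / b = a' / b' := by
  obtain ⟨_, x, hxm, hx0, _, hbl, hfrac, hdom⟩ := h
  have hRR₁ : R ≤ R₁ := hdom.1
  have hRO : R ≤ O₁.toSubring := hRR₁.trans hR₁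
  have hx0K : (x : K) ≠ 0 := fun h0 => hx0 (Subtype.ext h0)
  have hvxle : O₁.valuation (x : K) ≤ 1 := (O₁.valuation_le_one_iff _).mpr (hRO x.2)
  -- `x` is a unit of `O₁`
  have hvx : O₁.valuation (x : K) = 1 := by
    by_contra hne
    have hlt : O₁.valuation (x : K) < 1 := lt_of_le_of_ne hvxle hne
    obtain ⟨y, hym, hvy⟩ := hy
    have hyx : (y : K) / x ∈ O₁ := hR₁ (hbl (div_mem_blowupRing (x : K) hym))
    have hv : O₁.valuation ((y : K) / x) ≤ 1 := (O₁.valuation_le_one_iff _).mpr hyx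
    rw [map_div₀, hvy, one_div, inv_le_one₀ ((Valuation.pos_iff _).mpr hx0K)] at hv
    exact absurd hv (not_le.mpr hlt)
  -- trivial case `a = 0`
  by_cases ha0 : a = 0
  · exact ⟨0, R.zero_mem, 1, R.one_mem, by simp, by simp [ha0]⟩
  have hb0 : b ≠ 0 := by
    rintro rfl
    rw [map_zero] at hvb
    exact zero_ne_one hvb
  obtain ⟨α, hα, β, hβ, hβinv, haeq⟩ := hfrac a ha
  obtain ⟨γ, hγ, δ, hδ, hδinv, hbeq⟩ := hfrac b hb
  have hβ0 : β ≠ 0 := by rintro rfl; exact ha0 (by simpa using haeq)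
  have hδ0 : δ ≠ 0 := by rintro rfl; exact hb0 (by simpa using hbeq)
  have hγ0 : γ ≠ 0 := by rintro rfl; exact hb0 (by simpa using hbeq)
  obtain ⟨c₁, hc₁, N₁, hα'⟩ := exists_eq_div_pow_of_mem_blowupRing hx0K x.2 hα
  obtain ⟨d₁, hd₁, M₁, hβ'⟩ := exists_eq_div_pow_of_mem_blowupRing hx0K x.2 hβ
  obtain ⟨c₂, hc₂, N₂, hγ'⟩ := exists_eq_div_pow_of_mem_blowupRing hx0K x.2 hγ
  obtain ⟨d₂, hd₂, M₂, hδ'⟩ := exists_eq_div_pow_of_mem_blowupRing hx0K x.2 hδ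
  have hxpow : ∀ n : ℕ, (x : K) ^ n ≠ 0 := fun n => pow_ne_zero n hx0K
  have hd₁0 : d₁ ≠ 0 := by
    rintro rfl; exact hβ0 (by simpa using hβ')
  have hd₂0 : d₂ ≠ 0 := by
    rintro rfl; exact hδ0 (by simpa using hδ')
  have hc₂0 : c₂ ≠ 0 := by
    rintro rfl; exact hγ0 (by simpa using hγ')
  -- values
  have hvβ : O₁.valuation β = 1 :=
    ValuationSubring.valuation_eq_one_of_mem_of_inv_mem O₁ hβ0 (hR₁ (hbl hβ)) (hR₁ hβinv)
  have hvδ : O₁.valuation δ = 1 :=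
    ValuationSubring.valuation_eq_one_of_mem_of_inv_mem O₁ hδ0 (hR₁ (hbl hδ)) (hR₁ hδinv)
  have hd₁eq : d₁ = β * (x : K) ^ M₁ := by
    rw [hβ', div_mul_cancel₀ _ (hxpow M₁)]
  have hc₂eq : c₂ = b * δ * (x : K) ^ N₂ := by
    rw [hbeq, div_mul_cancel₀ _ hδ0, hγ', div_mul_cancel₀ _ (hxpow N₂)]
  have hvd₁ : O₁.valuation d₁ = 1 := by rw [hd₁eq, map_mul, map_pow, hvβ, hvx, one_pow, one_mul]
  have hvc₂ : O₁.valuation c₂ = 1 := by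
    rw [hc₂eq, map_mul, map_mul, map_pow, hvb, hvδ, hvx, one_pow]; simp
  refine ⟨c₁ * d₂ * (x : K) ^ (M₁ + N₂), R.mul_mem (R.mul_mem hc₁ hd₂) (R.pow_mem x.2 _),
    d₁ * c₂ * (x : K) ^ (N₁ + M₂), R.mul_mem (R.mul_mem hd₁ hc₂) (R.pow_mem x.2 _), ?_, ?_⟩
  · rw [map_mul, map_mul, map_pow, hvd₁, hvc₂, hvx]; simp
  · rw [haeq, hbeq, hα', hβ', hγ', hδ']
    field_simp
    ring

end ShannonDescent

section Main

variable {K : Type u} [Field K]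

/-- **The coarsening structure of a Shannon extension that is a valuation ring** (the heart of
HLOST Thm. 8.1 (1) ⇒ (3), via Lemma 3.2): if `⋃ R i = O` for the quadratic sequence `R` of a regular
local ring along `O`, then every proper coarsening `O < O₁ ≠ K` is a discrete valuation ring and is the
localisation of some member `R j` at a height-one prime. [cite: HeinzerEtAl2015, Lemma 3.2, Thm. 4.1,
Rem. 4.3, Thm. 8.1] -/
theorem shannon_coarsening_isDiscreteValuationRing (O : ValuationSubring K) (R : ℕ → Subring K)
    (hreg : IsRegularLocalRing (R 0)) (hdom : SubringDominates (R 0) O.toSubring)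
    (hqt : ∀ i, IsQuadraticTransformAlong O (R i) (R (i + 1)))
    (hU : ∀ z : K, z ∈ O → ∃ i, z ∈ R i)
    (O₁ : ValuationSubring K) (hlt : O < O₁) (hne : O₁ ≠ ⊤) :
    IsDiscreteValuationRing O₁ ∧
      ∃ (i : ℕ) (P : Ideal (R i)), P.IsPrime ∧ P.height = 1 ∧
        ∀ z : K, z ∈ O₁ ↔ ∃ a b : R i, b ∉ P ∧ z = (a : K) / (b : K) := by
  classical
  have hOO₁ : O ≤ O₁ := hlt.le
  -- bookkeeping along the sequence
  have hseq : ∀ n, SubringDominates (R n) O.toSubring ∧ SubringDominates (R 0) (R n) :=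
    sequence_dominates hdom hqt
  have hmono : Monotone R := sequence_monotone hqt
  haveI hloc : ∀ n, IsLocalRing (R n) := fun n => by
    rcases n with _ | n
    · exact hreg.toIsLocalRing
    · exact (hqt n).isLocalRing
  have hregI : ∀ n, IsRegularLocalRing (R n) := by
    intro n
    induction n with
    | zero => exact hreg
    | succ n ih => exact (hqt n).isRegularLocalRing_of_isRegularLocalRing ih
  have hRO₁ : ∀ n, R n ≤ O₁.toSubring := fun n => (hseq n).1.1.trans hOO₁
  -- the prime of `O` below `O₁` is neither `⊥` nor `𝔪`: pick `y ∈ 𝔪_O` which is a unit of `O₁`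
  set P := O.idealOfLE O₁ hOO₁ with hPdef
  have hPne : P ≠ maximalIdeal O := fun h =>
    (ne_of_lt hlt) ((ValuationSubring.idealOfLE_eq_maximalIdeal_iff O O₁ hOO₁).mp h).symm
  obtain ⟨y, hym, hyP⟩ : ∃ y : O, y ∈ maximalIdeal O ∧ y ∉ P := by
    have hPle : P ≤ maximalIdeal O := IsLocalRing.le_maximalIdeal (Ideal.IsPrime.ne_top inferInstance)
    by_contra hcon
    push Not at hcon
    exact hPne (le_antisymm hPle fun y hy => hcon y hy)
  have hvy : O₁.valuation (y : K) = 1 := by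
    rcases O₁.valuation_lt_one_or_eq_one ⟨(y : K), hOO₁ y.2⟩ with h | h
    · exact absurd ((O₁.valuation_lt_one_iff _).mpr h) hyP
    · exact h
  obtain ⟨j, hyj⟩ := hU y y.2
  -- `y` stays in the maximal ideal of every later member (domination by `O`)
  have hymem : ∀ n, j ≤ n → ∃ y' : R n, y' ∈ maximalIdeal (R n) ∧ O₁.valuation (y' : K) = 1 := by
    intro n hn
    refine ⟨⟨(y : K), hmono hn hyj⟩, ?_, hvy⟩
    rw [IsLocalRing.mem_maximalIdeal, mem_nonunits_iff]
    intro hunit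
    have hyO : IsUnit (y : O) := by
      rw [isUnit_subring_iff_inv_mem] at hunit ⊢
      exact ⟨hunit.1, (hseq n).1.1 hunit.2⟩
    exact (IsLocalRing.mem_maximalIdeal _).mp hym hyO
  -- descent of fractions from `R n` (`n ≥ j`) to `R j`
  have hdesc : ∀ d : ℕ, ∀ a b : K, a ∈ R (j + d) → b ∈ R (j + d) → O₁.valuation b = 1 →
      ∃ a' ∈ R j, ∃ b' ∈ R j, O₁.valuation b' = 1 ∧ a / b = a' / b' := by
    intro d
    induction d with
    | zero => exact fun a b ha hb hvb => ⟨a, ha, b, hb, hvb, rfl⟩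
    | succ d ih =>
      intro a b ha hb hvb
      have hq : IsQuadraticTransform (R (j + d)) (R (j + d + 1)) :=
        (hqt (j + d)).isQuadraticTransform (hseq (j + d)).1
      obtain ⟨a₁, ha₁, b₁, hb₁, hvb₁, heq⟩ :=
        hq.exists_div_eq_descend O₁ (hRO₁ _) (hymem (j + d) (Nat.le_add_right j d)) ha hb hvb
      obtain ⟨a', ha', b', hb', hvb', heq'⟩ := ih a₁ b₁ ha₁ hb₁ hvb₁
      exact ⟨a', ha', b', hb', hvb', heq.trans heq'⟩
  -- the prime of `R j` under `O₁`
  let Q : Ideal (R j) := (maximalIdeal O₁).comap (Subring.inclusion (hRO₁ j))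
  have hQ : ∀ b : R j, b ∈ Q ↔ O₁.valuation (b : K) < 1 := fun b => by
    change Subring.inclusion (hRO₁ j) b ∈ maximalIdeal O₁ ↔ _
    exact O₁.valuation_lt_one_iff _
  have hQ' : ∀ b : R j, b ∉ Q ↔ O₁.valuation (b : K) = 1 := fun b => by
    rw [hQ]
    rcases O₁.valuation_lt_one_or_eq_one ⟨(b : K), hRO₁ j b.2⟩ with h | h
    · exact ⟨fun h' => absurd h h', fun h' => by rw [h']; exact lt_irrefl _⟩
    · exact ⟨fun _ => h, fun _ => by rw [h]; exact lt_irrefl _⟩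
  -- membership form of `O₁`
  have hmemO₁ : ∀ z : K, z ∈ O₁ ↔ ∃ a b : R j, b ∉ Q ∧ z = (a : K) / (b : K) := by
    intro z
    constructor
    · intro hz
      by_cases hz0 : z = 0
      · exact ⟨0, 1, (hQ' 1).mpr (by simp), by simp [hz0]⟩
      obtain ⟨a, s, haO, hsO, hvs, hzas⟩ :
          ∃ a s : K, a ∈ O ∧ s ∈ O ∧ O₁.valuation s = 1 ∧ z = a / s := by
        by_cases hzO : z ∈ O
        · exact ⟨z, 1, hzO, O.one_mem, by simp, by simp⟩
        · have hzi : z⁻¹ ∈ O := (O.mem_or_inv_mem z).resolve_left hzO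
          refine ⟨1, z⁻¹, O.one_mem, hzi, ?_, by rw [one_div, inv_inv]⟩
          exact ValuationSubring.valuation_eq_one_of_mem_of_inv_mem O₁ (inv_ne_zero hz0) (hOO₁ hzi)
            (by rw [inv_inv]; exact hz)
      obtain ⟨i₁, ha⟩ := hU a haO
      obtain ⟨i₂, hs⟩ := hU s hsO
      have han : a ∈ R (j + (i₁ + i₂)) := hmono (by omega) ha
      have hsn : s ∈ R (j + (i₁ + i₂)) := hmono (by omega) hs
      obtain ⟨a', ha', b', hb', hvb', heq⟩ := hdesc (i₁ + i₂) a s han hsn hvs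
      exact ⟨⟨a', ha'⟩, ⟨b', hb'⟩, (hQ' _).mpr hvb', by rw [hzas, heq]⟩
    · rintro ⟨a, b, hb, rfl⟩
      have hvb := (hQ' b).mp hb
      have : O₁.valuation ((a : K) / b) ≤ 1 := by
        rw [map_div₀, hvb, div_one]
        exact (O₁.valuation_le_one_iff _).mpr (hRO₁ j a.2)
      exact (O₁.valuation_le_one_iff _).mp this
  -- `O₁` is the localisation of `R j` at `Q`
  letI alg : Algebra (R j) O₁ := (Subring.inclusion (hRO₁ j)).toAlgebra
  have halg : ∀ r : R j, ((algebraMap (R j) O₁ r : O₁) : K) = (r : K) := fun r => rfl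
  haveI hQprime : Q.IsPrime := Ideal.comap_isPrime _ _
  haveI : IsLocalization.AtPrime O₁ Q := by
    refine ⟨?_, ?_, ?_⟩
    · rintro ⟨s, hs⟩
      have hvs : O₁.valuation (s : K) = 1 := (hQ' s).mp hs
      exact (O₁.valuation_eq_one_iff _).mpr hvs
    · intro z
      obtain ⟨a, b, hb, hz⟩ := (hmemO₁ z).mp z.2
      have hb0 : (b : K) ≠ 0 := by
        intro h0
        have := (hQ' b).mp hb
        rw [h0, map_zero] at this
        exact zero_ne_one this
      refine ⟨(a, ⟨b, hb⟩), ?_⟩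
      apply Subtype.ext
      change (z : K) * (b : K) = (a : K)
      rw [hz, div_mul_cancel₀ _ hb0]
    · intro x₁ x₂ h
      have : (x₁ : K) = x₂ := by
        have := congrArg (fun t : O₁ => (t : K)) h
        simpa [halg] using this
      exact ⟨1, by rw [Subtype.ext this]⟩
  haveI : IsRegularLocalRing (R j) := hregI j
  haveI : IsNoetherianRing O₁ :=
    IsLocalization.isNoetherianRing Q.primeCompl O₁ (inferInstance : IsNoetherianRing (R j))
  have hnf : ¬ IsField O₁ := ValuationSubring.not_isField_of_ne_top' O₁ hne
  haveI hdvr : IsDiscreteValuationRing O₁ :=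
    ((IsDiscreteValuationRing.TFAE O₁ hnf).out 0 1).mpr (inferInstance : ValuationRing O₁)
  -- height one
  have hh : Q.height = 1 := by
    have h1 := IsLocalization.AtPrime.ringKrullDim_eq_height Q O₁
    rw [IsDiscreteValuationRing.ringKrullDim_eq_one] at h1
    have h2 : ((1 : ℕ∞) : WithBot ℕ∞) = (Q.height : WithBot ℕ∞) := h1
    exact (WithBot.coe_injective h2).symm
  exact ⟨hdvr, j, Q, hQprime, hh, hmemO₁⟩

/-- **HLOST 2017, Thm. 8.1 (1) ⇒ (3) with Thm. 4.1 (1) / Rem. 4.3 — PROVED** (discharge of the named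
fact `HeinzerEtAl2015ShannonValuationRankTwo`): for the quadratic sequence `R` of a regular local ring
along a dominating valuation ring `O` with `⋃ R i = O`, either `dim O ≤ 1`, or `dim O = 2` and the
valuation ring strictly between `O` and the field is a discrete valuation ring, the localisation of some
member at a height-one prime.  Proof: `shannon_coarsening_isDiscreteValuationRing` for every proper
coarsening, then the counting lemmas of `ValuationSubringCoarseningDim.lean`. (The hypotheses
`IsLocalRingOf (R 0)` and `2 ≤ dim (R i)` of the fact — Setting 3.1 of the paper — are not needed by this
route.) [cite: HeinzerEtAl2015, Thm. 8.1 (1)⇒(3), Lemma 3.2, Thm. 4.1 (1), Rem. 4.3] -/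
theorem HeinzerEtAl2015ShannonValuationRankTwo_holds : HeinzerEtAl2015ShannonValuationRankTwo.{u} := by
  intro K _ O R hreg _hof _hdim hdom hqt hU
  by_cases hc : ∃ O₁ : ValuationSubring K, O < O₁ ∧ O₁ ≠ ⊤
  · obtain ⟨O₁, hlt, hne⟩ := hc
    right
    have key := fun (O' : ValuationSubring K) (h1 : O < O') (h2 : O' ≠ ⊤) =>
      shannon_coarsening_isDiscreteValuationRing O R hreg hdom hqt hU O' h1 h2
    refine ⟨le_antisymm (ValuationSubring.ringKrullDim_le_two_of_forall O fun O' h1 h2 => (key O' h1 h2).1)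
      (ValuationSubring.two_le_ringKrullDim_of_lt O O₁ hlt hne), O₁, hlt, hne, (key O₁ hlt hne).1,
      (key O₁ hlt hne).2⟩
  · left
    push Not at hc
    exact ValuationSubring.ringKrullDim_le_one_of_forall O hc

end Main




end Literature.AlgebraicGeometry.Resolution

end
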